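import Summits.BirchSwinnertonDyer.BirchSwinnertonDyer.Theorems.TeichmullerTwistDescentManinUnitFromKatoTwistInputs
import Literature.NumberTheory.EllipticCurves.ManinConstantQuadraticTwistIstarProofs
import HarnessLib

/-!
# Route `TeichmullerTwistDescent`, cruxes PSMU (stmt-BirchSwinnertonDyer-22638) / SCMU57
# (stmt-BirchSwinnertonDyer-22639): the quadratic-twist lattice tools at an UNSTARRED additive prime —
# Stevens' Lemma (5.2) under `ord_q Δ_min < 6`, and the `Γ₀` twist step with a `g(χ)²` shift (`--supports`)

Cell `pub/bsd-wall` (D-0145 line route-BirchSwinnertonDyer-TeichmullerTwistDescent, OPEN rev 1), seat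
`bsd-line-ttd-p2` (prover 2/2, g2). THEOREMS ONLY (no definition, no named fact, no `sorry`); nothing is
closed, no item is booked, BSD is not proved by this. Consumer: the sibling
`TeichmullerTwistDescentManinAtMostOnceFiveLe.lean` (Manin's `p`-part `≤ 1` at every additive `p ≥ 5` granted
Kato's fact F″, by the `p*`-twist at the additive prime itself).

* §0 `valuation_ringOfIntegers_Δ_eq` — `|Δ(W)|_v = exp(−ord_q Δ_min(W))` at the place of `𝓞 ℚ` over `q`, for
  a globally minimal `W` (bookkeeping between the cell's `padicValInt` currency and Mathlib's adic valuations).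
* §1 `isGloballyMinimal_twistModel_pStar_of_lt_six`, `neronLattice_quadraticTwist_pStar_of_lt_six` —
  **Stevens 1989 Lemma (5.2) at an odd prime `q` under `ord_q Δ_min(W) < 6`** (Pal 2012 Prop. 2.5's condition
  `λ_q(E) < 6`; covers `W` good at `q` AND `W` additive at `q ≥ 5` of Kodaira type II, III, IV): the integral
  `q*`-twist model of `W` is globally minimal, so every globally minimal model `C` of `W ⊗ χ_{q*}` has
  `Λ(C) = (√q*)⁻¹ Λ(W)`. The tree's named fact `stevens1989_neronLattice_quadraticTwist_oddPrime` (discharged in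
  `ManinConstantQuadraticTwistStevensHoldsProofs.lean`) asks `W` to be good or multiplicative at `q`; the proof
  here is the same, with the `q`-minimality of the twist model read off `ord_q Δ(T) = ord_q Δ_min(W) + 6 < 12`
  (Silverman *AEC* VII.1 Remark 1.1) instead of semistability.
* §2 `dvd_mul_of_charTwist_gamma0_of_sq` — **the `Γ₀` twist step of Stevens §5 with the partner datum inside
  `g(χ)⁻¹ Λ_W`**: for a lattice-optimal `X₀(N)`-datum `D` of `W` (`Λ_W = c Λ(f_D)`), any datum `D'` of a curve
  `A` with `Λ_A = g(χ)⁻¹ Λ_W` and `f_D = (f_{D'})_χ` (`χ` primitive quadratic mod `m`, `m² ∣ N`, level of `D'`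
  dividing `N`), and `g(χ)² = d`: `c ∣ d · c(D')`. Compare the tree's `maninConstant_dvd_of_charTwist_gamma0`
  (partner lattice `g(χ) Λ_C` for a third minimal curve `C`, conclusion `c ∣ c(D')`): when `A ≅ W ⊗ χ_{p*}`
  at an ADDITIVE `p` of `W` the roles force the shift by `g(χ)² = p*` — one factor `p`.

References: [Stevens1989] Lemma (5.2) p. 96, Lemma (5.4) p. 97, (2.8) p. 88; [Pal2012] Prop. 2.5, Lemma 3.1;
[Shimura1971] Prop. 3.64; [SilvermanAEC2009] VII.1 Remark 1.1, Prop. 1.3(b), VIII.8.3.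
-/

set_option autoImplicit false
-- single-conjunct summit: `Summit.BirchSwinnertonDyer.BirchSwinnertonDyer.…` repeats the name by design
set_option linter.dupNamespace false

noncomputable section

open scoped Classical MatrixGroups ModularForm

open WeierstrassCurve IsDedekindDomain IsDedekindDomain.HeightOneSpectrum Rat.HeightOneSpectrum NumberField
  Literature.NumberTheory.EllipticCurves Literature.NumberTheory.EllipticCurves.ModularForms
  Literature.NumberTheory.EllipticCurves.Rank1Residual Literature.NumberTheory.DiophantineGeometry
  Summit.BirchSwinnertonDyer.Rank1Residual Summit.BirchSwinnertonDyer.Rank1Residual.Additive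
  Summit.BirchSwinnertonDyer.BirchSwinnertonDyer.Theses.TeichmullerTwistDescent
  Summit.BirchSwinnertonDyer.BirchSwinnertonDyer.Theorems CongruenceSubgroup

namespace Summit.BirchSwinnertonDyer.BirchSwinnertonDyer.Theorems.TeichmullerTwistDescent

/-! ### §0 The discriminant valuation at a place of `𝓞 ℚ` -/

/-- For a globally minimal `W/ℚ` and the place `v` of `𝓞 ℚ` over the prime `q`:
`|Δ(W)|_v = exp(−ord_q Δ_min(W))`. [cite: SilvermanAEC2009, VIII.8 (minimal discriminant)] -/
theorem valuation_ringOfIntegers_Δ_eq (W : WeierstrassCurve ℚ) [W.IsElliptic] [W.IsGloballyMinimal]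
    (v : HeightOneSpectrum (𝓞 ℚ)) :
    v.valuation ℚ W.Δ =
      WithZero.exp (-(padicValInt (primesEquiv v : ℕ) W.minimalDiscriminantInt : ℤ)) := by
  set q : ℕ := (primesEquiv v : ℕ) with hq
  have hqp : q.Prime := (primesEquiv v).2
  haveI : Fact q.Prime := ⟨hqp⟩
  set Δ : ℤ := W.minimalDiscriminantInt with hΔ
  have hΔ0 : Δ ≠ 0 := W.minimalDiscriminantInt_ne_zero
  set n : ℕ := padicValInt q Δ with hn
  -- `Δ = q^n · e` with `q ∤ e`
  obtain ⟨e, he⟩ : (q : ℤ) ^ n ∣ Δ := padicValInt_dvd Δ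
  have hqe : ¬ (q : ℤ) ∣ e := by
    intro h
    have h' : (q : ℤ) ^ (n + 1) ∣ Δ := by
      rw [he, pow_succ]
      exact mul_dvd_mul_left _ h
    rw [padicValInt_dvd_iff (n + 1) Δ] at h'
    rcases h' with h' | h'
    · exact hΔ0 h'
    · omega
  rw [← cast_minimalDiscriminantInt W, ← hΔ, he]
  push_cast
  rw [map_mul, map_pow, valuation_ringOfIntegers_natCast_primesEquiv,
    valuation_ringOfIntegers_intCast_eq_one v (by exact_mod_cast hqe), mul_one, ← WithZero.exp_nsmul]
  simp

/-! ### §1 Stevens' Lemma (5.2) at an odd prime `q` with `ord_q Δ_min(W) < 6` (Pal's condition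
`λ_q(E) < 6`): the integral `q*`-twist model is globally minimal, so `Λ(W ⊗ χ_{q*}) = (√q*)⁻¹ Λ(W)` -/

section Twist

variable (W : WeierstrassCurve ℚ) [W.IsElliptic] [W.IsGloballyMinimal] {q : ℕ} [hq' : Fact q.Prime]

/-- `4 · ((q* − 1)/4) + 1 = q*` for odd `q`. [folklore] -/
private theorem four_mul_k_add_one (hq2 : q ≠ 2) :
    4 * (((-1 : ℤ) ^ (q / 2) * q - 1) / 4) + 1 = (-1 : ℤ) ^ (q / 2) * q := by
  have h4 := four_dvd_pStar_sub_one (p := q) hq2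
  have := Int.ediv_mul_cancel h4
  linarith [this]

/-- `q ∥ q*`. [folklore] -/
private theorem dvd_pStar_not_sq_dvd :
    ((q : ℕ) : ℤ) ∣ (-1 : ℤ) ^ (q / 2) * q ∧ ¬ ((q : ℕ) : ℤ) ^ 2 ∣ (-1 : ℤ) ^ (q / 2) * q := by
  have hq : q.Prime := Fact.out
  refine ⟨Dvd.intro_left _ rfl, fun h ↦ ?_⟩
  have hu : IsUnit ((-1 : ℤ) ^ (q / 2)) := (isUnit_neg_one (α := ℤ)).pow _
  have h' : ((q : ℕ) : ℤ) ^ 2 ∣ (q : ℤ) := (hu.dvd_mul_left).mp h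
  have h1 : ((q : ℤ) : ℤ) * q ∣ (q : ℤ) * 1 := by simpa [sq] using h'
  have hq0 : (q : ℤ) ≠ 0 := by exact_mod_cast hq.ne_zero
  have h2 : (q : ℤ) ∣ 1 := (mul_dvd_mul_iff_left hq0).mp h1
  exact hq.one_lt.ne' (by exact_mod_cast Int.eq_one_of_dvd_one (by positivity) h2)

/-- **The integral `q*`-twist model of a globally minimal `W` with `ord_q Δ_min(W) < 6` is globally
minimal** (`q` odd; covers `W` good at `q` and the unstarred additive types II, III, IV at `q ≥ 5`): at
`v ≠ q` the twisting parameter is a `v`-unit (`isMinimalAt_twistModel`); at `v = q`,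
`ord_q Δ(T) = ord_q Δ_min(W) + 6 < 12` (Silverman *AEC* VII.1 Remark 1.1; Pal 2012 Prop. 2.5, condition
`λ_q(E) < 6`). Verbatim the argument of `isGloballyMinimal_twistModel_pStar` (semistable case) with the
discriminant bound in place of semistability. [cite: Pal2012, Prop. 2.5] [cite: SilvermanAEC2009, VII.1 Remark 1.1] -/
theorem isGloballyMinimal_twistModel_pStar_of_lt_six (hq2 : q ≠ 2)
    (h6 : padicValInt q W.minimalDiscriminantInt < 6) :
    (W.twistModel (((((-1 : ℤ) ^ (q / 2) * q - 1) / 4 : ℤ) : ℚ))).IsGloballyMinimal := by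
  have hq : q.Prime := Fact.out
  set d : ℤ := (-1 : ℤ) ^ (q / 2) * q with hd
  set k : ℤ := (d - 1) / 4 with hk
  have h4k : (4 : ℤ) * k + 1 = d := four_mul_k_add_one hq2
  have h4kℚ : (4 : ℚ) * (k : ℚ) + 1 = (d : ℚ) := by exact_mod_cast h4k
  have hkO : algebraMap (𝓞 ℚ) ℚ ((k : ℤ) : 𝓞 ℚ) = (k : ℚ) := by simp
  have hint : IsIntegral (𝓞 ℚ) (W.twistModel (k : ℚ)) := by
    have := isIntegral_twistModel (𝓞 ℚ) W ((k : ℤ) : 𝓞 ℚ)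
    rwa [hkO] at this
  set M : WeierstrassCurve ℤ := integralModelInt W with hM
  have hWM : M.map (Int.castRingHom ℚ) = W := map_integralModelInt W
  have hTM : (M.twistModel k).map (Int.castRingHom ℚ) = W.twistModel (k : ℚ) := by
    rw [map_twistModel, hWM, eq_intCast]
  have hintv : ∀ v : HeightOneSpectrum (𝓞 ℚ), (W.twistModel (k : ℚ)).IsIntegralAt v := by
    intro v
    refine (W.twistModel (k : ℚ)).isIntegralAt_of_valuation_le_one v ?_ ?_ ?_ ?_ ?_
    · rw [← hTM, map_a₁, eq_intCast]; exact valuation_ringOfIntegers_intCast_le_one v _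
    · rw [← hTM, map_a₂, eq_intCast]; exact valuation_ringOfIntegers_intCast_le_one v _
    · rw [← hTM, map_a₃, eq_intCast]; exact valuation_ringOfIntegers_intCast_le_one v _
    · rw [← hTM, map_a₄, eq_intCast]; exact valuation_ringOfIntegers_intCast_le_one v _
    · rw [← hTM, map_a₆, eq_intCast]; exact valuation_ringOfIntegers_intCast_le_one v _
  refine ⟨hint, fun v ↦ ?_⟩
  have hpP : (primesEquiv v : ℕ).Prime := (primesEquiv v).2
  by_cases hvq : (primesEquiv v : ℕ) = q
  · -- the ramified place `v = q`: `ord_q Δ(T) = 6 + ord_q Δ_min(W) < 12`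
    have hvd : v.valuation ℚ (d : ℚ) = WithZero.exp (-1 : ℤ) := by
      obtain ⟨h1, h2⟩ := dvd_pStar_not_sq_dvd (q := q)
      exact valuation_ringOfIntegers_intCast_eq_exp_neg_one v (by rw [hvq]; exact h1)
        (by rw [hvq]; exact h2)
    have hv4k : v.valuation ℚ (4 * (k : ℚ) + 1) = WithZero.exp (-1 : ℤ) := by rw [h4kℚ, hvd]
    have hvΔ : v.valuation ℚ W.Δ =
        WithZero.exp (-(padicValInt q W.minimalDiscriminantInt : ℤ)) := by
      rw [valuation_ringOfIntegers_Δ_eq W v, hvq]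
    have hΔ : v.valuation ℚ (W.twistModel (k : ℚ)).Δ =
        WithZero.exp (-6 - (padicValInt q W.minimalDiscriminantInt : ℤ)) := by
      rw [twistModel_Δ, map_mul, map_pow, hv4k, hvΔ, ← WithZero.exp_nsmul, ← WithZero.exp_add]
      congr 1
    exact isMinimalAt_of_lt_valuation_Δ_holds (hintv v)
      (by rw [hΔ]; exact WithZero.exp_lt_exp.mpr (by omega))
  · -- an unramified place `v ≠ q`: `q*` is a `v`-unit
    have hnd : ¬ ((primesEquiv v : ℕ) : ℤ) ∣ d := by
      intro h
      have hu : IsUnit ((-1 : ℤ) ^ (q / 2)) := (isUnit_neg_one (α := ℤ)).pow _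
      have h' : ((primesEquiv v : ℕ) : ℤ) ∣ (q : ℤ) := (hu.dvd_mul_left).mp h
      exact hvq ((Nat.prime_dvd_prime_iff_eq hpP hq).mp (Int.natCast_dvd_natCast.mp h'))
    have hvd : v.valuation ℚ (d : ℚ) = 1 := valuation_ringOfIntegers_intCast_eq_one v hnd
    have hv4k : v.valuation ℚ (4 * (k : ℚ) + 1) = 1 := by rw [h4kℚ, hvd]
    exact isMinimalAt_twistModel v W (IsGloballyMinimal.isMinimal v)
      (valuation_ringOfIntegers_intCast_le_one v k) hv4k

/-- **Stevens' Lemma (5.2) at an odd prime `q` with `ord_q Δ_min(W) < 6`** (Pal 2012 Prop. 2.5): for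
`W/ℚ` globally minimal with Néron pair `L`, every globally minimal model `C` of `W ⊗ χ_{q*}` with Néron
pair `L'`, and `s² = q*`: `z ∈ Λ(C) ↔ s z ∈ Λ(W)`, i.e. `Λ(C) = s⁻¹ Λ(W)` — the conclusion of the tree's
`stevens1989_neronLattice_quadraticTwist_oddPrime` with its hypothesis "good or multiplicative at `q`"
replaced by `ord_q Δ_min(W) < 6` (so also for `W` additive at `q ≥ 5` of Kodaira type II, III or IV).
Proof verbatim that of `stevens1989_neronLattice_quadraticTwist_oddPrime_holds` with §1's minimality.
[cite: Stevens1989, Lemma (5.2) p. 96] [cite: Pal2012, Prop. 2.5 and Lemma 3.1]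
[cite: SilvermanAEC2009, VII.1 Prop. 1.3(b) and VIII.8.3] -/
theorem neronLattice_quadraticTwist_pStar_of_lt_six {L : PeriodPair}
    (hL : IsNeronLatticeOf (W.baseChange ℂ) L) (hq2 : q ≠ 2)
    (h6 : padicValInt q W.minimalDiscriminantInt < 6)
    (C : WeierstrassCurve ℚ) [C.IsElliptic] [C.IsGloballyMinimal]
    (hCtw : ∃ v : VariableChange ℚ, v • W.quadraticTwist (((-1 : ℤ) ^ (q / 2) * q : ℤ) : ℚ) = C)
    {L' : PeriodPair} (hL' : IsNeronLatticeOf (C.baseChange ℂ) L')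
    {s : ℂ} (hs : s ^ 2 = (((-1 : ℤ) ^ (q / 2) * q : ℤ) : ℂ)) (z : ℂ) :
    z ∈ L'.lattice ↔ s * z ∈ L.lattice := by
  have hq : q.Prime := Fact.out
  set d : ℤ := (-1 : ℤ) ^ (q / 2) * q with hd
  set k : ℤ := (d - 1) / 4 with hk
  have h4k : (4 : ℤ) * k + 1 = d := four_mul_k_add_one hq2
  have h4kℚ : (4 : ℚ) * (k : ℚ) + 1 = (d : ℚ) := by exact_mod_cast h4k
  have hdZ : d ≠ 0 := by
    rw [hd]
    exact mul_ne_zero (pow_ne_zero _ (by norm_num)) (by exact_mod_cast hq.ne_zero)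
  have hd0 : (d : ℚ) ≠ 0 := by exact_mod_cast hdZ
  have hs0 : s ≠ 0 := by
    rintro rfl
    have h0 : ((d : ℤ) : ℂ) = 0 := by rw [← hs]; simp
    exact hdZ (by exact_mod_cast h0)
  set T : WeierstrassCurve ℚ := W.twistModel (k : ℚ) with hT
  haveI hTmin : T.IsGloballyMinimal := isGloballyMinimal_twistModel_pStar_of_lt_six W hq2 h6
  have hLT : IsNeronLatticeOf (T.baseChange ℂ) (L.mulLeft s⁻¹ (inv_ne_zero hs0)) :=
    isNeronLatticeOf_twistModel (k : ℚ) hL hs0 (by rw [hs, h4kℚ]; push_cast; rfl)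
  obtain ⟨v, hv⟩ := hCtw
  obtain ⟨C₀, -, hC₀⟩ := exists_variableChange_twistModel_eq_quadraticTwist W (k : ℚ)
  rw [h4kℚ] at hC₀
  have hCw : C = (v * C₀) • T := by rw [mul_smul, hT, hC₀, hv]
  haveI : T.IsElliptic := by
    haveI : (W.quadraticTwist (d : ℚ)).IsElliptic := W.isElliptic_quadraticTwist hd0
    have h : T = C₀⁻¹ • W.quadraticTwist (d : ℚ) := by
      rw [← hC₀, ← mul_smul, inv_mul_cancel, one_smul]
    rw [h]; infer_instance
  haveI : ((v * C₀) • T).IsGloballyMinimal := by rw [← hCw]; infer_instance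
  have hu : (v * C₀).u = 1 ∨ (v * C₀).u = -1 := (isGloballyMinimal_unique_holds T (v * C₀)).1
  have hL'T : IsNeronLatticeOf (((v * C₀) • T).baseChange ℂ) L' := by rw [← hCw]; exact hL'
  have hΛ := IsNeronLatticeOf.lattice_eq_mulLeft_of_smul (v * C₀) hLT hL'T
  rw [hΛ, PeriodPair.mem_mulLeft_lattice, PeriodPair.mem_mulLeft_lattice, inv_inv, ← mul_assoc]
  rcases hu with h1 | h1
  · rw [h1]; simp
  · rw [h1]
    simp only [Units.val_neg, Units.val_one, Rat.cast_neg, Rat.cast_one, inv_neg, inv_one,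
      mul_neg, mul_one, neg_mul]
    exact neg_mem_iff

end Twist

/-! ### §2 The lattice chain with a shift: `c₀(𝒜) ∣ g(χ)² · c(D')` when `Λ_A = g(χ)⁻¹ Λ_W` -/

section Chain

variable {A : WeierstrassCurve ℚ} {N' : ℕ} [NeZero N']
  {W : WeierstrassCurve ℚ} {N : ℕ} [NeZero N]
  {m : ℕ} [NeZero m] {χ : DirichletCharacter ℂ m}

/-- **The twist step on `X₀` with the partner INSIDE the `g(χ)`-scaled Néron lattice of the optimal curve:
`c₀(𝒜) ∣ g(χ)²·c(D')`.** Data: a lattice-optimal `X₀(N)`-datum `D` of the globally minimal `W`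
(`Λ_W = c Λ(f_D)`), any `X₀(N')`-datum `D'` of a curve `A` (`c' Λ(f_{D'}) ⊆ Λ_A`), a primitive quadratic `χ`
mod `m` with `N' ∣ N`, `m² ∣ N`, `aₙ(f_D) = χ(n) aₙ(f_{D'})` (so `f_D = (f_{D'})_χ`), `g(χ)² = d ∈ ℤ`, and
`Λ_A = g(χ)⁻¹ Λ_W` (the situation `A ≅ W ⊗ χ` with `W` semistable or of type II/III/IV at the conductor of
`χ`: Stevens' Lemma (5.2) / §1). Then `c ∣ d · c'`: `z = c w ∈ Λ_W ⇒ g w ∈ Λ(f_{D'})`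
(`gaussSum_mul_mem_periodLattice_of_mem_charTwist`) `⇒ c' g w ∈ Λ_A ⇒ g c' g w = d c' w ∈ Λ_W`, so
`(d c'/c) Λ_W ⊆ Λ_W` and `d c'/c ∈ ℤ` (`int_of_rat_mul_mem_lattice_self`). Compare
`maninConstant_dvd_of_charTwist_gamma0` (partner lattice `g(χ)·Λ_C` for a THIRD minimal curve `C`, no shift).
[cite: Stevens1989, Lemma (5.4) p. 97 and (2.8) p. 88] [cite: Shimura1971, Prop. 3.64] -/
theorem dvd_mul_of_charTwist_gamma0_of_sq
    (D' : ModularParametrizationData A N') (D : ModularParametrizationData W N)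
    (h : ∀ z ∈ D.L.lattice, ∃ w ∈ periodLattice D.f, z = D.c * w)
    (hχ : χ.IsQuadratic) (hprim : χ.IsPrimitive) (hN : N' ∣ N) (hm : m ^ 2 ∣ N)
    (hf : ∀ n : ℕ, cuspCoeff D.f n = χ n * cuspCoeff D'.f n)
    {d : ℤ} (hG : gaussSum χ (ZMod.stdAddChar (N := m)) ^ 2 = (d : ℂ))
    (hLA : ∀ z : ℂ, z ∈ D'.L.lattice ↔ gaussSum χ (ZMod.stdAddChar (N := m)) * z ∈ D.L.lattice) :
    D.c ∣ d * D'.c := by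
  set G : ℂ := gaussSum χ (ZMod.stdAddChar (N := m)) with hGdef
  have hfeq : D.f = charTwist N hN hm hχ D'.f :=
    eq_of_forall_cuspCoeff_eq_gamma0 fun n ↦ by rw [hf, cuspCoeff_charTwist N hN hm hχ hprim]
  have hc : D.c ≠ 0 := D.maninConstant_ne_zero_holds
  have hcℂ : (D.c : ℂ) ≠ 0 := by exact_mod_cast hc
  have key : ∀ z ∈ D.L.lattice, ((((d * D'.c : ℤ) : ℚ) / D.c : ℚ) : ℂ) * z ∈ D.L.lattice := by
    intro z hz
    obtain ⟨w, hw, rfl⟩ := h z hz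
    have hw' : G * w ∈ periodLattice D'.f := by
      rw [hfeq] at hw
      exact gaussSum_mul_mem_periodLattice_of_mem_charTwist N hN hm hχ hprim D'.f hw
    have h3 : (D'.c : ℂ) * (G * w) ∈ D'.L.lattice := D'.smul_periodLattice_le _ hw'
    have h4 : G * ((D'.c : ℂ) * (G * w)) ∈ D.L.lattice := (hLA _).mp h3
    have e : ((((d * D'.c : ℤ) : ℚ) / D.c : ℚ) : ℂ) * ((D.c : ℂ) * w) = G * ((D'.c : ℂ) * (G * w)) := by
      have e1 : G * ((D'.c : ℂ) * (G * w)) = G ^ 2 * (D'.c : ℂ) * w := by ring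
      rw [e1, hG]
      push_cast
      field_simp
    rw [e]
    exact h4
  obtain ⟨k, hk⟩ := int_of_rat_mul_mem_lattice_self D.L _ key
  have hcℚ : (D.c : ℚ) ≠ 0 := by exact_mod_cast hc
  have h' : ((d * D'.c : ℤ) : ℚ) = D.c * k := by
    rw [hk]
    field_simp
  exact ⟨k, by exact_mod_cast h'⟩

end Chain

end Summit.BirchSwinnertonDyer.BirchSwinnertonDyer.Theorems.TeichmullerTwistDescent

end
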